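import Summits.Ventures.HSemireg.Mod4TwoSlopeSpectrumGeneral

/-!
# Venture HSemireg — MOD-4 line: the middle-degree multiplicity SPLITS OVER THE SQUARE ROOT `T_f` of `M_f = (−1)ⁿ T_f²`:
# `ker(M_f(q) − (−1)ⁿμ²) = ker(T_f(q) − μ) ⊕ ker(T_f(q) + μ)` for every h-part `q` and every `μ ≠ 0` (characteristic `0`)

HONEST FRAMING. Part of the Lean index of the computation cell `pub-hsemireg` (seat w3-mod4-1 gen 14, W3 SPECIAL FIBRES; file of
record `HOME/widen/W3/MOD4-OFFSPLIT-w3mod4.md` §10.2 (C8) «`M_f = (−1)ⁿ(J·H_f·S·D)²` — loci = squares of the eigenvalues of one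
Hankel-built matrix» and §13.25 (the pin-set multiplicities)). ELEMENTARY LINEAR ALGEBRA over a field ONLY: no abelian variety, no
sheaf, no Ext group, no semiregularity map; nothing here says that HC / HC_CM / HC_AV holds; no Literature fact is declared; NO
definition is introduced.

WHAT IS PROVED (`K` a field with `CharZero K`, `q : ℕ → K` ARBITRARY, `μ ≠ 0`, `t = (−1)ⁿ μ²`; `T_f = hankelT n q`, `M_f = middleM n q` of
`Mod4MiddleMatrixSquareRoot`, where `middleM_eq_smul_hankelT_sq : M_f = (−1)ⁿ • T_f²`):
* **`mem_ker_middleM_of_hankelT_eigen`** — `T_f v = μ v` (or `= −μ v`) ⇒ `v ∈ ker(M_f − t)`;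
* **`ker_middleM_sub_eq_sup`** — `ker(M_f − t) = ker(T_f − μ) ⊔ ker(T_f + μ)` (for `v` in the left kernel, `u = T_f v + μv ∈ ker(T_f − μ)`,
  `w = T_f v − μv ∈ ker(T_f + μ)` and `v = (2μ)⁻¹(u − w)`);
* **`ker_hankelT_sub_inf_ker_add_eq_bot`** — `ker(T_f − μ) ⊓ ker(T_f + μ) = ⊥` (`2μ v = 0 ⇒ v = 0`);
* **`finrank_ker_middleM_eq_add`** — `dim ker(M_f − t) = dim ker(T_f − μ) + dim ker(T_f + μ)`;
* **`finrank_ker_middleM_eq_of_ker_add_eq_bot`** — if `T_f + μ` is injective then `dim ker(M_f − t) = dim ker(T_f − μ)`.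
USE (§13.25): for the `ch(O_Z)`-shapes `T_f` is triangular with diagonal `(−1)^b C(n,b) q_n`; at the pin `t_a = (−1)ⁿ C(n,a)² q_n²`,
`μ_a = (−1)^a C(n,a) q_n`: for ODD `n` both `±μ_a` are simple eigenvalues (entries `a`, `n − a`) ⇒ `1 + 1 = 2`
(`Mod4LeadingTermPins.finrank_ker_middleM_leading_pin_odd`, proved there directly); for EVEN `n` `−μ_a` is NOT an eigenvalue, so the
middle-degree drop is the geometric multiplicity of the double eigenvalue `μ_a` of the triangular `T_f` — a problem LINEAR in the
tail `q_{n+1}, …, q_{2n}` (`n = 2`: drop `2` iff `3q₂q₄ = 2q₃²`; companion file `Mod4LeadingTermPinsEven`). Everything PROVED, 0 sorry.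
Namespace `Summit.Ventures.HSemireg.Mod4`.
References: [BourbakiAlgebre1a3] Ch. III §8 (kernels, direct sums); [BuchweitzFlenner2008HH] Prop. 6.4.4 (why these matrices).
-/

namespace Summit.Ventures.HSemireg.Mod4

open Finset Matrix

variable {K : Type*} [Field K]

/-- `v ∈ ker(toLin' A − c • id) ↔ A v = c • v`. -/
theorem mem_ker_toLin'_sub_smul_iff {m : Type*} [Fintype m] [DecidableEq m] (A : Matrix m m K) (c : K) (v : m → K) :
    v ∈ LinearMap.ker (Matrix.toLin' A - c • LinearMap.id) ↔ A *ᵥ v = c • v := by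
  rw [LinearMap.mem_ker, LinearMap.sub_apply, LinearMap.smul_apply, LinearMap.id_apply, Matrix.toLin'_apply, sub_eq_zero]

/-- `v ∈ ker(toLin' A + c • id) ↔ A v = −c • v`. -/
theorem mem_ker_toLin'_add_smul_iff {m : Type*} [Fintype m] [DecidableEq m] (A : Matrix m m K) (c : K) (v : m → K) :
    v ∈ LinearMap.ker (Matrix.toLin' A + c • LinearMap.id) ↔ A *ᵥ v = -c • v := by
  rw [LinearMap.mem_ker, LinearMap.add_apply, LinearMap.smul_apply, LinearMap.id_apply, Matrix.toLin'_apply, neg_smul,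
    eq_neg_iff_add_eq_zero]

/-- **`M_f v` for a `T_f`-eigenvector:** `T_f v = c v` ⇒ `M_f v = ((−1)ⁿ c²) v`. [cite: BourbakiAlgebre1a3, Ch. III §8] -/
theorem middleM_mulVec_of_hankelT_eigen {n : ℕ} (q : ℕ → K) {c : K} {v : Fin (n + 1) → K} (hv : hankelT n q *ᵥ v = c • v) :
    middleM n q *ᵥ v = ((-1 : K) ^ n * (c * c)) • v := by
  rw [middleM_eq_smul_hankelT_sq, Matrix.smul_mulVec, ← Matrix.mulVec_mulVec, hv, Matrix.mulVec_smul, hv, smul_smul, smul_smul,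
    ← mul_assoc]

/-- **an eigenvector of `T_f` for `μ` or for `−μ` lies in `ker(M_f − (−1)ⁿμ²)`.** [cite: BourbakiAlgebre1a3, Ch. III §8] -/
theorem mem_ker_middleM_of_hankelT_eigen {n : ℕ} (q : ℕ → K) {μ t : K} (ht : t = (-1 : K) ^ n * (μ * μ))
    {v : Fin (n + 1) → K} (hv : hankelT n q *ᵥ v = μ • v ∨ hankelT n q *ᵥ v = -μ • v) :
    v ∈ LinearMap.ker (Matrix.toLin' (middleM n q) - t • LinearMap.id) := by
  rw [mem_ker_toLin'_sub_smul_iff]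
  rcases hv with hv | hv
  · rw [middleM_mulVec_of_hankelT_eigen q hv, ht]
  · rw [middleM_mulVec_of_hankelT_eigen q hv, ht, neg_mul_neg]

/-- **the two root kernels are disjoint:** `ker(T_f − μ) ⊓ ker(T_f + μ) = ⊥` for `μ ≠ 0` (`CharZero K`): `μv = T_f v = −μv ⇒ 2μv = 0`.
[cite: BourbakiAlgebre1a3, Ch. III §8] -/
theorem ker_hankelT_sub_inf_ker_add_eq_bot [CharZero K] {n : ℕ} (q : ℕ → K) {μ : K} (hμ : μ ≠ 0) :
    LinearMap.ker (Matrix.toLin' (hankelT n q) - μ • LinearMap.id) ⊓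
      LinearMap.ker (Matrix.toLin' (hankelT n q) + μ • LinearMap.id) = ⊥ := by
  rw [Submodule.eq_bot_iff]
  intro v hv
  rw [Submodule.mem_inf, mem_ker_toLin'_sub_smul_iff, mem_ker_toLin'_add_smul_iff] at hv
  have h : (2 * μ) • v = 0 := by
    have e : (2 * μ) • v = μ • v - (-μ) • v := by module
    rw [e, ← hv.1, ← hv.2, sub_self]
  rcases smul_eq_zero.mp h with h1 | h1
  · exact absurd h1 (mul_ne_zero two_ne_zero hμ)
  · exact h1

/-- **the kernel splits over the square root:** `ker(M_f − (−1)ⁿμ²) = ker(T_f − μ) ⊔ ker(T_f + μ)` for every `q` and `μ ≠ 0`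
(`CharZero K`). For `v` on the left, `u = T_f v + μ v` satisfies `(T_f − μ)u = T_f²v − μ²v = (−1)ⁿ(M_f − t)v = 0` and
`w = T_f v − μ v` satisfies `(T_f + μ)w = 0`, with `v = (2μ)⁻¹(u − w)`. [cite: BourbakiAlgebre1a3, Ch. III §8]
[cite: BuchweitzFlenner2008HH, Prop. 6.4.4] -/
theorem ker_middleM_sub_eq_sup [CharZero K] {n : ℕ} (q : ℕ → K) {μ t : K} (hμ : μ ≠ 0) (ht : t = (-1 : K) ^ n * (μ * μ)) :
    LinearMap.ker (Matrix.toLin' (middleM n q) - t • LinearMap.id) =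
      LinearMap.ker (Matrix.toLin' (hankelT n q) - μ • LinearMap.id) ⊔
        LinearMap.ker (Matrix.toLin' (hankelT n q) + μ • LinearMap.id) := by
  apply le_antisymm
  · intro v hv
    rw [mem_ker_toLin'_sub_smul_iff] at hv
    set T := hankelT n q with hT
    -- `T² v = μ² v`
    have hsq : T *ᵥ (T *ᵥ v) = (μ * μ) • v := by
      have h1 : middleM n q *ᵥ v = ((-1 : K) ^ n) • (T *ᵥ (T *ᵥ v)) := by
        rw [middleM_eq_smul_hankelT_sq, Matrix.smul_mulVec, ← Matrix.mulVec_mulVec]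
      have hs : ((-1 : K) ^ n) * ((-1 : K) ^ n) = 1 := by rw [← pow_add, ← two_mul, pow_mul, neg_one_sq, one_pow]
      calc T *ᵥ (T *ᵥ v) = (((-1 : K) ^ n) * ((-1 : K) ^ n)) • (T *ᵥ (T *ᵥ v)) := by rw [hs, one_smul]
        _ = ((-1 : K) ^ n) • (middleM n q *ᵥ v) := by rw [h1, smul_smul]
        _ = (μ * μ) • v := by rw [hv, ht, smul_smul, ← mul_assoc, hs, one_mul]
    set u := T *ᵥ v + μ • v with hu
    set w := T *ᵥ v - μ • v with hw
    have hu' : u ∈ LinearMap.ker (Matrix.toLin' T - μ • LinearMap.id) := by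
      rw [mem_ker_toLin'_sub_smul_iff, hu, Matrix.mulVec_add, Matrix.mulVec_smul, hsq]
      module
    have hw' : w ∈ LinearMap.ker (Matrix.toLin' T + μ • LinearMap.id) := by
      rw [mem_ker_toLin'_add_smul_iff, hw, Matrix.mulVec_sub, Matrix.mulVec_smul, hsq]
      module
    rw [Submodule.mem_sup]
    refine ⟨(2 * μ)⁻¹ • u, Submodule.smul_mem _ _ hu', -((2 * μ)⁻¹ • w), Submodule.neg_mem _ (Submodule.smul_mem _ _ hw'), ?_⟩
    have h2 : (2 * μ)⁻¹ * (2 * μ) = 1 := inv_mul_cancel₀ (mul_ne_zero two_ne_zero hμ)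
    calc (2 * μ)⁻¹ • u + -((2 * μ)⁻¹ • w) = ((2 * μ)⁻¹ * (2 * μ)) • v := by rw [hu, hw]; module
      _ = v := by rw [h2, one_smul]
  · rw [sup_le_iff]
    constructor
    · intro v hv
      rw [mem_ker_toLin'_sub_smul_iff] at hv
      exact mem_ker_middleM_of_hankelT_eigen q ht (Or.inl hv)
    · intro v hv
      rw [mem_ker_toLin'_add_smul_iff] at hv
      exact mem_ker_middleM_of_hankelT_eigen q ht (Or.inr hv)

/-- **the middle-degree multiplicity is the sum of the two root multiplicities:** `dim ker(M_f − (−1)ⁿμ²) = dim ker(T_f − μ) +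
dim ker(T_f + μ)` for every `q` and `μ ≠ 0` (`CharZero K`). [cite: BourbakiAlgebre1a3, Ch. III §8] [cite: BuchweitzFlenner2008HH, Prop. 6.4.4] -/
theorem finrank_ker_middleM_eq_add [CharZero K] {n : ℕ} (q : ℕ → K) {μ t : K} (hμ : μ ≠ 0) (ht : t = (-1 : K) ^ n * (μ * μ)) :
    Module.finrank K ↥(LinearMap.ker (Matrix.toLin' (middleM n q) - t • LinearMap.id)) =
      Module.finrank K ↥(LinearMap.ker (Matrix.toLin' (hankelT n q) - μ • LinearMap.id)) +
        Module.finrank K ↥(LinearMap.ker (Matrix.toLin' (hankelT n q) + μ • LinearMap.id)) := by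
  have h := Submodule.finrank_sup_add_finrank_inf_eq
    (LinearMap.ker (Matrix.toLin' (hankelT n q) - μ • LinearMap.id))
    (LinearMap.ker (Matrix.toLin' (hankelT n q) + μ • LinearMap.id))
  rw [ker_hankelT_sub_inf_ker_add_eq_bot q hμ, finrank_bot, add_zero, ← ker_middleM_sub_eq_sup q hμ ht] at h
  exact h

/-- **one root only:** if `T_f + μ` is injective (`−μ` is not an eigenvalue of `T_f`), then `dim ker(M_f − (−1)ⁿμ²) = dim ker(T_f − μ)`.
[cite: BourbakiAlgebre1a3, Ch. III §8] -/
theorem finrank_ker_middleM_eq_of_ker_add_eq_bot [CharZero K] {n : ℕ} (q : ℕ → K) {μ t : K} (hμ : μ ≠ 0)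
    (ht : t = (-1 : K) ^ n * (μ * μ)) (hinj : LinearMap.ker (Matrix.toLin' (hankelT n q) + μ • LinearMap.id) = ⊥) :
    Module.finrank K ↥(LinearMap.ker (Matrix.toLin' (middleM n q) - t • LinearMap.id)) =
      Module.finrank K ↥(LinearMap.ker (Matrix.toLin' (hankelT n q) - μ • LinearMap.id)) := by
  rw [finrank_ker_middleM_eq_add q hμ ht, hinj, finrank_bot, add_zero]

end Summit.Ventures.HSemireg.Mod4
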